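import Summits.AnomalousDissipation.AnomalousDissipation.Theorems.SolenoidalFractalHomogenisationLagrangianStepZ7GlueDefsR
import Summits.AnomalousDissipation.AnomalousDissipation.Theorems.SolenoidalFractalHomogenisationLagrangianStepTailScales
import HarnessLib

/-!
# K1L_D (stmt-AnomalousDissipation-27980), §9z glue v3, D27-4′ (iii): the BRIDGE `alphaBeta_textP_of_textR` — the REGISTERED (guarded) αβ text
# implies the PRE-PROJECTED αβ text the glue core `Z7Glue.cellInputs_BIL_ofP` consumes (helper, `--supports 27980 --as helper`; prover ad-k1loc-p3 g9)

`Z7Glue.cellInputs_alphaBeta_textR` (p704133, prover ad-sawtooth-k1loc-p1 g14; text of record for `stub_Z7_alphaBetaR`, rulings D27-4/D27-4′ on finding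
F-p3g9-2) asks (N1′)/(N1*′) for WEAKLY SOLENOIDAL data; `Z7Glue.cellInputs_alphaBeta_textP` asks them at the Leray projection `Pσ x`, `Pσ y` with the
N-currency of the ORIGINAL datum.  The bridge: `Pσ v` is weakly solenoidal (`mem_divFreeL2_iff` + `starProjection_apply_mem`), so (N1′) applies to it,
and `Pσ` does not increase the N-currency — `X2 (Pσ x) ≤ X2 x`, the Leray multiplier being a modewise contraction with all weights of `X2` in `[0,1]`
and tail weight `1`: the tree's `LagrangianStep.nsq_starProjection_le` (lead-k1l-onelevel-p1, `…CellInputsBilinearLeray`).  With it the registry-v23 line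
`stub_cellInputs_BIL := Z7Glue.cellInputs_BIL_ofP stub_Vmod_of_VR (Z7Glue.alphaBeta_textP_of_textR stub_Z7_alphaBetaR)` type-checks.
NOT (N1′), not the glue, not the stub, not K1L_D, not AD; rung F-D1.A0.
-/

set_option linter.dupNamespace false

noncomputable section

namespace Summit.AnomalousDissipation.AnomalousDissipation.Theorems.SolenoidalFractalHomogenisation.LagrangianStep.Z7Glue

open Literature.Analysis Literature.Analysis.FluidPDE Literature.Analysis.FunctionSpaces
open MeasureTheory Set Filter UnitAddTorus
open scoped ENNReal NNReal InnerProductSpace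
open Literature.Analysis.FluidPDE.LatticeShear (LagrangianLatticeCarrier LatticeWord)
open Summit.AnomalousDissipation.AnomalousDissipation.Theorems.SolenoidalFractalHomogenisation.LagrangianStep.CellClauseMod

/-- **BRIDGE (D27-4′ (iii))**: the registered (guarded) αβ text implies the pre-projected αβ text the glue consumes — apply (N1′)/(N1*′) to the weakly
solenoidal `Pσ x`, `Pσ y` and use that `Pσ` does not increase the N-currency (`LagrangianStep.nsq_starProjection_le`; the weights
`min 1 (rate_k·τ)` are nonnegative because `a, lo, c, ν, N > 0` and `τ = s′ − jR ≥ R > 0`). -/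
theorem alphaBeta_textP_of_textR (h : cellInputs_alphaBeta_textR) : cellInputs_alphaBeta_textP := by
  intro k W M hM c hc Φ lo hi Λ β σ C ν₀ K Cf νf Kf hlo hlo1 hhi hΛ hβ hσ hC hν₀ hK hV hCf hνf hKf hF hH
  obtain ⟨ν₁, hν₁, K₁, hK₁, Λ₀, θ₀, hθ₀, Cα, hCα, ϱ, hϱ, CN, hCN, Cmono, hCmono, hE⟩ :=
    h k W M hM c hc Φ lo hi Λ β σ C ν₀ K Cf νf Kf hlo hlo1 hhi hΛ hβ hσ hC hν₀ hK hV hCf hνf hKf hF hH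
  refine ⟨ν₁, hν₁, K₁, hK₁, Λ₀, θ₀, hθ₀, Cα, hCα, ϱ, hϱ, CN, hCN, Cmono, hCmono, ?_⟩
  intro E hdes hgain hnu0 hKE hLP hReg hT1 hN2 hT2 hT3 hT4 hT5
  obtain ⟨mstar, hm⟩ := hE E hdes hgain hnu0 hKE hLP hReg hT1 hN2 hT2 hT3 hT4 hT5
  refine ⟨mstar, fun m hmm => ?_⟩
  intro Lc hLc S hSo hSn hΦSo hΦSn Um Um1 hUm hUm1 Sf hSf j s' h1 h2 h3
  obtain ⟨hFC1, hFC2, hN1, hN1s, hN2'⟩ := hm m hmm Lc hLc S hSo hSn hΦSo hΦSn Um Um1 hUm hUm1 Sf hSf j s' h1 h2 h3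
  have hw0 : ∀ k' : Fin 3 → ℤ, 0 ≤ min 1 ((E.a (m + 1) * (8 * Real.pi ^ 2 * ‖Torus.latticeVec k'‖ ^ 2 * lo *
      (E.cellVisc (m + 1) + c / E.cellVisc (m + 1)) / (E.N (m + 1) : ℝ) ^ 2)) * (s' - (j : ℝ) * E.refresh (m + 1))) := by
    intro k'
    have ha := E.a_pos (m + 1)
    have hν := LagrangianRenormalisationStep.cellVisc_pos' E.toFractalCarrierData (m + 1)
    have hR := E.refresh_pos (m + 1)
    have hτ : 0 ≤ s' - (j : ℝ) * E.refresh (m + 1) := by linarith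
    refine le_min zero_le_one ?_
    positivity
  have hdiv : ∀ v : V2, Torus.IsWeaklyDivFree (⇑((Torus.divFreeL2 (Fin 3)).starProjection v) : VF) := fun v =>
    (Torus.mem_divFreeL2_iff _).1 ((Torus.divFreeL2 (Fin 3)).starProjection_apply_mem v)
  refine ⟨hFC1, hFC2, fun x => ?_, fun y => ?_, hN2'⟩
  · exact (hN1 _ (hdiv x)).trans (mul_le_mul_of_nonneg_left (nsq_starProjection_le Sf _ hw0 x) hCN.le)
  · exact (hN1s _ (hdiv y)).trans (mul_le_mul_of_nonneg_left (nsq_starProjection_le Sf _ hw0 y) hCN.le)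

end Summit.AnomalousDissipation.AnomalousDissipation.Theorems.SolenoidalFractalHomogenisation.LagrangianStep.Z7Glue

end
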